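import Literature.NumberTheory.Automorphic.Liu2021.AppendixC.EtaleBettiComparison
import Literature.NumberTheory.Automorphic.Liu2021.AppendixC.RestOneLevelInvariants
import HarnessLib

/-!
# [Liu 2021, §4.2 l. 2077–2081] gluing a levelwise realisation of the Betti tower along a Betti pinning

Topic `NumberTheory/Automorphic/Liu2021/AppendixC`; namespace `Literature.NumberTheory.Automorphic.Liu2021.AppendixC`, dot-notation
on a Betti pinning `B : C.BettiPinning T τ' H rhoB` (★ `EtaleBettiComparison` §4) of a tower module `(H, rhoB)` of a §4.2 datum
`C : Sec42Data P5 isotropicAt` with Hecke translates `T`.  THEOREMS ONLY (no definition, no named fact, no instance, no `sorry`).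

PRINT ([Liu2021] §4.2, FJcycle.tex l. 2077–2081): «Put `H¹_{B,τ'}(A_∞, ℂ) := lim_K H¹_{B,τ'}(A_K, ℂ)`, which is an admissible
representation of `𝔾(𝔸_F^∞)`»; §D.3 l. 5357: «`H¹_B(Sh(G,h), ℂ) := lim_K H¹_B(Sh(G,h)_K, ℂ)` … of `G(𝔸^∞)`-modules» — every
`G(𝔸^∞)`-equivariant construction on the tower (Matsushima's realisation by automorphic forms, [BorelWallach2000, XIII 1.2]) is made
LEVEL BY LEVEL and glued along the transition maps.  This file is that gluing, once and for all, for an ARBITRARY pinning (the pinning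
axioms `b_injective`, `b_hecke`, `exhaust` say exactly that `H` is the colimit with the induced Hecke action):

* `exists_realisation_of_levelFamily` — a family of INJECTIVE `ℂ`-linear maps `f_K : H¹_{B,τ'}(A_K, ℂ) → X` with values in a
  submodule `A ≤ X`, compatible with the Hecke translates (`f_K ∘ Alb(T_g)^* = R(g) ∘ f_{K'}` for `g⁻¹Kg ⊆ K'`; at `g = 1` this is
  compatibility with the transition pull-backs `Alb_u^*`) GLUES to an injective `R`-equivariant `ℂ`-linear `r : H → X` with values in
  `A` and `r ∘ b_K = f_K`;
* the bookkeeping it rests on: `b_eq_b_pull` (a level class is the class of its pull-back to a smaller level), `levelFamily_pull`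
  (so is its realisation), `levelFamily_wd` (two level representatives of one tower class have the same realisation).

Consumer: the floor-0 letter `S1RealisationShape` of `Cruxes/HLiu418/Lines/F0_AlbCmS1Betti` (realisation of the record-curve Betti tower
in the `(1,0) ⊕ (0,1)` cotangent automorphic forms of `U(J⋆)`, [Liu2021, §D.3 (D.1)]): its proof is this gluing applied to the levelwise
Hodge ∕ cone-pull-back ∕ adelic-lift family.  HC_CM is proved only modulo the 7 printed citations until rung 0 closes; nothing printed is
asserted here.

## References
* [Liu2021] Y. Liu, *Fourier–Jacobi cycles and arithmetic relative trace formula*, Camb. J. Math. 9 (2021): §4.2 l. 2066–2081, §D.3 l. 5357.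
* [BorelWallach2000] A. Borel, N. Wallach, *Continuous cohomology, discrete subgroups, and representations of reductive groups*, 2nd ed.,
  XIII 1.2 (the `G(𝔸_f)`-module `colim_K H^•(Γ_K \ X)`).
* [Milne2005ShimuraVarieties] J. S. Milne, *Introduction to Shimura varieties* (2005), §5 p. 57–58, §13 p. 118 (Hecke operators `T(g)`).
-/

set_option autoImplicit false

noncomputable section

open CategoryTheory NumberField

namespace Literature.NumberTheory.Automorphic.Liu2021.AppendixC

variable {F E : Type} [Field F] [NumberField F] [IsTotallyReal F] [Field E] [NumberField E] [Algebra F E]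
  [IsTotallyComplex E] [Algebra.IsQuadraticExtension F E]
variable {P5 : PropC5Data F E} {isotropicAt : ℕ → Prop}

namespace Sec42Data.BettiPinning

variable {C : Sec42Data P5 isotropicAt} {T : C.HeckeTranslates} {τ' : E →+* ℂ} {H : Type} [AddCommGroup H] [Module ℂ H]
  {rhoB : Representation ℂ C.G H} (B : C.BettiPinning T τ' H rhoB)

/-- A level-`K` class is, in the tower, the class of its pull-back `Alb_u^* y` to any smaller level `L ⊆ K` (`b_hecke` at `g = 1`,
`Alb(T_1) = Alb_u`). [cite: Liu2021, §4.2 l. 2070–2079] -/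
theorem b_eq_b_pull {K L : C5.SmallLevel C.S.K₀} (hLK : L ≤ K) (y : C.bettiH1 τ' K) :
    B.b K y = B.b L (bettiPullAlong τ' (C.Atr (homOfLE hLK)) y) := by
  rw [← T.albTr_one (homOfLE hLK)]
  exact B.b_one L K (C5.HeckeLE.one_of_le hLK) y

variable {X : Type} [AddCommGroup X] [Module ℂ X] (R : Representation ℂ C.G X)
  (f : ∀ K : C5.SmallLevel C.S.K₀, C.bettiH1 τ' K →ₗ[ℂ] X)

/-- A Hecke-compatible level family is compatible with the transition pull-backs: `f_L (Alb_u^* y) = f_K y` for `L ⊆ K`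
(`g = 1`, `R 1 = 1`). [cite: Liu2021, §4.2 l. 2070–2079] -/
theorem levelFamily_pull
    (hhecke : ∀ (g : C.G) (K K' : C5.SmallLevel C.S.K₀) (h : C5.HeckeLE g K K') (y : C.bettiH1 τ' K'),
      f K (bettiPullAlong τ' (T.albTr g K K' h) y) = R g (f K' y))
    {K L : C5.SmallLevel C.S.K₀} (hLK : L ≤ K) (y : C.bettiH1 τ' K) :
    f L (bettiPullAlong τ' (C.Atr (homOfLE hLK)) y) = f K y := by
  have h := hhecke 1 L K (C5.HeckeLE.one_of_le hLK) y
  rwa [T.albTr_one (homOfLE hLK), map_one, Module.End.one_apply] at h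

/-- **Well-definedness on the tower**: two level representatives of the same tower class have the same realisation (pass to a common
refinement `L ⊆ K ∩ K'`, ★ `C5.SmallLevel.exists_le_le`; there the pull-backs agree by `b_injective`). [cite: Liu2021, §4.2 l. 2077–2081] -/
theorem levelFamily_wd
    (hhecke : ∀ (g : C.G) (K K' : C5.SmallLevel C.S.K₀) (h : C5.HeckeLE g K K') (y : C.bettiH1 τ' K'),
      f K (bettiPullAlong τ' (T.albTr g K K' h) y) = R g (f K' y))
    {K K' : C5.SmallLevel C.S.K₀} (y : C.bettiH1 τ' K) (y' : C.bettiH1 τ' K') (hyy' : B.b K y = B.b K' y') :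
    f K y = f K' y' := by
  obtain ⟨L, hLK, hLK'⟩ := C5.SmallLevel.exists_le_le K K'
  have hb : B.b L (bettiPullAlong τ' (C.Atr (homOfLE hLK)) y) = B.b L (bettiPullAlong τ' (C.Atr (homOfLE hLK')) y') := by
    rw [← B.b_eq_b_pull hLK y, ← B.b_eq_b_pull hLK' y', hyy']
  have hpull := B.b_injective L hb
  rw [← levelFamily_pull R f hhecke hLK y, ← levelFamily_pull R f hhecke hLK' y', hpull]

/-- **GLUING A LEVELWISE REALISATION ALONG A BETTI PINNING.**  Let `(H, rhoB)` be pinned to the Betti levels of the tower by `B`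
(injective level maps `b_K`, jointly exhaustive, `rhoB g ∘ b_{K'} = b_K ∘ Alb(T_g)^*`), and let `f_K : H¹_{B,τ'}(A_K, ℂ) → X` be
INJECTIVE `ℂ`-linear maps with values in `A ≤ X`, compatible with the Hecke translates for a representation `R` of `𝔾(𝔸_F^∞)` on `X`
(`f_K (Alb(T_g)^* y) = R g (f_{K'} y)` whenever `g⁻¹Kg ⊆ K'`).  Then there is an INJECTIVE `ℂ`-linear `r : H → X`, `R`-EQUIVARIANT for
`rhoB`, with values in `A`, and with `r (b_K y) = f_K y` at every level — «`H¹_{B,τ'}(A_∞, ℂ) := lim_K H¹_{B,τ'}(A_K, ℂ)` … an admissible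
representation of `𝔾(𝔸_F^∞)`» realised level by level ([BorelWallach2000, XIII 1.2]).  Proof: `r x := f_K y` for any representative
`b_K y = x` (`exhaust`), independent of the choice (`levelFamily_wd`); additivity and homogeneity at a common level; injectivity from
that of `f_K` and `b_K 0 = 0`; equivariance from `b_hecke` at the conjugate level `gK'g⁻¹ ∩ K₀` (★ `C5.heckeLevel`).
[cite: Liu2021, §4.2 l. 2074–2081; §D.3 l. 5357] [cite: BorelWallach2000, XIII 1.2] [cite: Milne2005ShimuraVarieties, §13 p. 118 L21–26] -/
theorem exists_realisation_of_levelFamily (A : Submodule ℂ X)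
    (hmem : ∀ (K : C5.SmallLevel C.S.K₀) (y : C.bettiH1 τ' K), f K y ∈ A)
    (hinj : ∀ K : C5.SmallLevel C.S.K₀, Function.Injective (f K))
    (hhecke : ∀ (g : C.G) (K K' : C5.SmallLevel C.S.K₀) (h : C5.HeckeLE g K K') (y : C.bettiH1 τ' K'),
      f K (bettiPullAlong τ' (T.albTr g K K' h) y) = R g (f K' y)) :
    ∃ r : H →ₗ[ℂ] X, Function.Injective r ∧ (∀ x, r x ∈ A) ∧ (∀ (g : C.G) (x : H), r (rhoB g x) = R g (r x)) ∧
      ∀ (K : C5.SmallLevel C.S.K₀) (y : C.bettiH1 τ' K), r (B.b K y) = f K y := by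
  classical
  -- a representative of each tower class
  let Kof : H → C5.SmallLevel C.S.K₀ := fun x => (B.exhaust x).choose
  let yof : ∀ x : H, C.bettiH1 τ' (Kof x) := fun x => (B.exhaust x).choose_spec.choose
  have hrep : ∀ x : H, B.b (Kof x) (yof x) = x := fun x => (B.exhaust x).choose_spec.choose_spec
  -- the glued map, as a function
  let r₀ : H → X := fun x => f (Kof x) (yof x)
  have hr₀ : ∀ (K : C5.SmallLevel C.S.K₀) (y : C.bettiH1 τ' K), r₀ (B.b K y) = f K y := fun K y =>
    B.levelFamily_wd R f hhecke _ _ (hrep (B.b K y))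
  -- two classes at a common level
  have hcommon : ∀ x x' : H, ∃ (L : C5.SmallLevel C.S.K₀) (z z' : C.bettiH1 τ' L), B.b L z = x ∧ B.b L z' = x' := by
    intro x x'
    obtain ⟨L, hL, hL'⟩ := C5.SmallLevel.exists_le_le (Kof x) (Kof x')
    exact ⟨L, bettiPullAlong τ' (C.Atr (homOfLE hL)) (yof x), bettiPullAlong τ' (C.Atr (homOfLE hL')) (yof x'),
      by rw [← B.b_eq_b_pull hL, hrep], by rw [← B.b_eq_b_pull hL', hrep]⟩
  have hadd : ∀ x x' : H, r₀ (x + x') = r₀ x + r₀ x' := by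
    intro x x'
    obtain ⟨L, z, z', rfl, rfl⟩ := hcommon x x'
    rw [← map_add, hr₀, hr₀, hr₀, map_add]
  have hsmul : ∀ (a : ℂ) (x : H), r₀ (a • x) = a • r₀ x := by
    intro a x
    conv_lhs => rw [← hrep x]
    rw [← map_smul, hr₀, map_smul, ← hr₀ (Kof x) (yof x), hrep]
  let r : H →ₗ[ℂ] X := { toFun := r₀, map_add' := hadd, map_smul' := hsmul }
  have hr : ∀ (K : C5.SmallLevel C.S.K₀) (y : C.bettiH1 τ' K), r (B.b K y) = f K y := hr₀
  refine ⟨r, ?_, ?_, ?_, hr⟩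
  · -- injective
    intro x x' hxx'
    obtain ⟨L, z, z', rfl, rfl⟩ := hcommon x x'
    rw [hr, hr] at hxx'
    rw [hinj L hxx']
  · -- values in `A`
    intro x
    rw [← hrep x, hr]
    exact hmem _ _
  · -- equivariance
    intro g x
    rw [← hrep x, B.b_hecke g (C5.heckeLevel g (Kof x)) (Kof x) (C5.heckeLE_heckeLevel g (Kof x)) (yof x), hr, hr, hhecke]

/-- The same gluing in the exact shape of the floor-0 letter `S1RealisationShape` (the level identities dropped).
[cite: Liu2021, §4.2 l. 2074–2081; §D.3 l. 5357] [cite: BorelWallach2000, XIII 1.2] -/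
theorem exists_realisation_of_levelFamily' (B : C.BettiPinning T τ' H rhoB) (A : Submodule ℂ X)
    (hmem : ∀ (K : C5.SmallLevel C.S.K₀) (y : C.bettiH1 τ' K), f K y ∈ A)
    (hinj : ∀ K : C5.SmallLevel C.S.K₀, Function.Injective (f K))
    (hhecke : ∀ (g : C.G) (K K' : C5.SmallLevel C.S.K₀) (h : C5.HeckeLE g K K') (y : C.bettiH1 τ' K'),
      f K (bettiPullAlong τ' (T.albTr g K K' h) y) = R g (f K' y)) :
    ∃ r : H →ₗ[ℂ] X, Function.Injective r ∧ (∀ x, r x ∈ A) ∧ ∀ (g : C.G) (x : H), r (rhoB g x) = R g (r x) := by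
  obtain ⟨r, h1, h2, h3, -⟩ := B.exists_realisation_of_levelFamily R f A hmem hinj hhecke
  exact ⟨r, h1, h2, h3⟩

end Sec42Data.BettiPinning

end Literature.NumberTheory.Automorphic.Liu2021.AppendixC

end
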